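/-
Copyright (c) 2026. All rights reserved.
Released under Apache 2.0 license as described in the file LICENSE.
Authors: abc-iut cell, campaign-S prover seat abc-iut-S7.
-/
import Mathlib.RingTheory.Localization.Module
import Literature.IUT.LogVolume.PadicModuleTopology
import Literature.IUT.LogVolume.IntegralBases
import HarnessLib

/-!
# Integral bases and the `ℤ_p`-lattice of a basis

Thin bridge between abc-iut-S5's integral bases (`IntegralBases.lean`: `exists_integralBasis` — a
`ℤ_p`-basis `bZ` of `𝒪_K` together with the `ℚ_p`-basis `bQ` of `K` it spans — and
`norm_repr_le_one` / `norm_le_one_of_norm_repr_le`) and the lattice language of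
`PadicModuleTopology.lean` (`PadicModule.basisLattice b = {x | all b-coordinates in ℤ_p}`): for an integral
basis the lattice is exactly `𝒪_K = {‖x‖ ≤ 1}` (`mem_basisLattice_iff_of_integralBasis`), in particular for
the localisation of ANY `ℤ_p`-basis of `𝒪_K` (`mem_basisLattice_localizationLocalization_iff`, the form
used with Smith-normal-form bases in `AdaptedBasis.lean`), and such bases exist
(`exists_integralBasis_basisLattice`).  Also records, as scoped instances, S1's `finiteDimensional` and
Mathlib's `IsIntegralClosure.isLocalization` (`K = 𝒪_K ⊗_{ℤ_p} ℚ_p`).  Classical (Serre, *Local Fields*,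
Ch. II §2); the consumer is the tensor-packet lattice `R_I = ⊗_{ℤ_p} 𝒪_{k_i}` of [IUTchIV] Prop. 1.1.
-/

noncomputable section

open Module
open scoped NormedField

namespace Literature.IUT.LogVolume

section OneField

variable (p : ℕ) [Fact p.Prime]
variable (K : Type*) [NontriviallyNormedField K] [instK : NormedAlgebra ℚ_[p] K] [IsUltrametricDist K]
  [ProperSpace K]

/-- A proper `K` is finite-dimensional over `ℚ_p` — `IntegerRingFinite.finiteDimensional` as a scoped
instance (Riesz; no new content). [folklore] -/
scoped instance (priority := 50) finiteDimensional_padic : FiniteDimensional ℚ_[p] K :=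
  finiteDimensional p K

/-- `K` is the localisation of `𝒪_K` at `ℤ_p ∖ 0` (`K = 𝒪_K ⊗_{ℤ_p} ℚ_p`; Mathlib
`IsIntegralClosure.isLocalization`), as a scoped instance. [folklore] -/
scoped instance isLocalization_integer_padic :
    IsLocalization (Algebra.algebraMapSubmonoid (Valued.integer K) (nonZeroDivisors ℤ_[p])) K :=
  IsIntegralClosure.isLocalization ℤ_[p] ℚ_[p] K (Valued.integer K)

variable {K}

omit [ProperSpace K] in
/-- **The lattice of an integral basis is `𝒪_K`**: if the `ℚ_p`-basis `bQ` consists of the vectors of a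
`ℤ_p`-basis `bZ` of `𝒪_K`, then `x ∈ basisLattice bQ ↔ ‖x‖ ≤ 1` (S5's `norm_repr_le_one` /
`norm_le_one_of_norm_repr_le`, rephrased; Serre: `B` is a free `A`-module of rank `[L:K]`).
[cite: SerreLocalFields1979, Ch. II §2, Prop. 3] -/
theorem mem_basisLattice_iff_of_integralBasis {κ : Type*} [Fintype κ] (bZ : Basis κ ℤ_[p] (Valued.integer K))
    (bQ : Basis κ ℚ_[p] K) (hb : ∀ j, bQ j = (bZ j : K)) (x : K) :
    x ∈ PadicModule.basisLattice p bQ ↔ ‖x‖ ≤ 1 :=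
  (PadicModule.mem_basisLattice p bQ).trans
    ⟨norm_le_one_of_norm_repr_le bZ bQ hb, fun hx j => norm_repr_le_one bZ bQ hb hx j⟩

/-- **Localised `ℤ_p`-bases of `𝒪_K` are integral bases**: for ANY `ℤ_p`-basis `b₀` of `𝒪_K`, the
`ℚ_p`-basis `b₀ ⊗ ℚ_p` of `K = 𝒪_K ⊗_{ℤ_p} ℚ_p` (Mathlib `Basis.localizationLocalization`) has `ℤ_p`-lattice
exactly `𝒪_K = {‖x‖ ≤ 1}`. [cite: SerreLocalFields1979, Ch. II §2, Prop. 3] -/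
theorem mem_basisLattice_localizationLocalization_iff {ι : Type*} [Fintype ι]
    (b₀ : Basis ι ℤ_[p] (Valued.integer K)) (x : K) :
    x ∈ PadicModule.basisLattice p (b₀.localizationLocalization ℚ_[p] (nonZeroDivisors ℤ_[p]) K) ↔
      ‖x‖ ≤ 1 :=
  mem_basisLattice_iff_of_integralBasis p b₀ _
    (fun j => Basis.localizationLocalization_apply ℚ_[p] (nonZeroDivisors ℤ_[p]) K b₀ j) x

variable (K) in
/-- **Integral bases exist, lattice form**: `K` has a `ℚ_p`-basis indexed by `Fin n`, `0 < n`, whose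
`ℤ_p`-lattice is exactly `𝒪_K` (from S5's `exists_integralBasis`; `n = [K : ℚ_p] > 0`).
[cite: SerreLocalFields1979, Ch. II §2, Prop. 3] -/
theorem exists_integralBasis_basisLattice :
    ∃ (n : ℕ) (b : Basis (Fin n) ℚ_[p] K),
      0 < n ∧ ∀ x : K, x ∈ PadicModule.basisLattice p b ↔ ‖x‖ ≤ 1 := by
  obtain ⟨n, bZ, bQ, hb⟩ := exists_integralBasis (p := p) K
  refine ⟨n, bQ, ?_, mem_basisLattice_iff_of_integralBasis p bZ bQ hb⟩
  have h := Module.finrank_eq_card_basis bQ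
  rw [Fintype.card_fin] at h
  rw [← h]
  exact Module.finrank_pos

end OneField

end Literature.IUT.LogVolume

end
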